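import Summits.HodgeConjecture.HodgeConjecture.Theorems.Ring2AbelianAllAndreCorrespondenceCategory
import Summits.HodgeConjecture.HodgeConjecture.Theorems.Ring2AbelianAllAndreLiebermanHolds
import Literature.AlgebraicGeometry.HodgeTheory.LefschetzStandardUnconditionalDegrees
import HarnessLib

/-!
# Crux `LefschetzStandardB` (stmt-HodgeConjecture-17489), line `birth` — stub 4 `stub_cayleyHamiltonTransfer`:
# Kleiman's Cayley–Hamilton transfer, for EVERY smooth projective complex variety

Route `HodgeConjecture/MotivatedLefschetzSplit`, crux #3 `LefschetzStandardB` (Grothendieck's `B(X)` in André's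
`*_L`-form for every smooth projective complex `X`); registered skeleton `Cruxes/LefschetzStandardB/Lines/birth.lean`
(`LefschetzStandardB_of : Sig.stub_lowerHalf → Sig.stub_familySupply → Sig.stub_charlesSpread →
Sig.stub_cayleyHamiltonTransfer → LefschetzStandardB`). This file closes the registered stub

* **`stub_cayleyHamiltonTransfer`** (signature VERBATIM; Kleiman 1968 Thm. 2A11 = Kleiman 1994 Thm. 4-1 = Charles 2013
  Lemma 6 = André 1996 §3.2 Remarque): for `Z` smooth projective of dimension `d`, a polarisation class `η` and
  `a + b = 2d`, if SOME bijective algebraic correspondence `θ : Hᵃ(Z(ℂ); ℂ) → Hᵇ(Z(ℂ); ℂ)` exists, then the Lefschetz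
  involution `*_L : Hᵃ → Hᵇ` is induced by an algebraic class on `Z × Z`.

Proof, on the tree's real carriers and for arbitrary smooth projective `Z` (the tree had it for abelian varieties only,
`Ring2AbelianAllAndreLiebermanHolds` §2, where `θ` is the Fourier correspondence): the degrees `a ≤ d` are the lower half
(`isAlgebraicCorrespondence_lefschetzInvolution_of_le`, no hypothesis used); for `d < a`, `a = b + 2j`, `b + j = d`,
`*_L = (Lʲ)⁻¹` and `u := θ ∘ Lʲ ∈ End Hᵇ(Z(ℂ); ℂ)` is an algebraic correspondence (`IsAlgebraicCorrespondence.comp_lefschetzPow`: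
`[γ_θ]_* ∘ Lʲ = [pr₂^* ηʲ ∪ γ_θ]_*`, Voisin II Prop. 9.20) and injective; by Cayley–Hamilton
(`exists_sum_smul_pow_comp_eq_id`: the minimal polynomial of an injective endomorphism has non-zero constant term)
`(Σ_k c_k uᵏ) ∘ u = 𝟙`, so `φ := (Σ_k c_k uᵏ) ∘ θ` satisfies `φ ∘ Lʲ = 𝟙`, i.e. `φ = (Lʲ)⁻¹ = *_L` (hard Lefschetz:
`Lʲ` is onto), and `φ` is an algebraic correspondence because algebraic self-correspondences are closed under
composition and `ℂ`-linear combinations (`IsAlgebraicCorrespondence.comp` / `.sum`, Fulton 16.1.1 with the tree's Gysin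
base change and the multiplicativity of algebraic classes — part XXII-e of the AbelianAll André axis). The registered
hypothesis "`*_L : Hᵇ → Hᵃ` is algebraic" is not consumed (it is itself a theorem, the lower half).

Nothing here is a case of the Hodge conjecture or of `B(X)`; no definition, no named fact, no sorry.
References: [Kleiman1968AlgebraicCycles] Appendix to §2, Thm. 2A11; S. Kleiman, *The standard conjectures*, Motives
(1994) Thm. 4-1; [Charles2013] Lemma 6 (arXiv:1002.5011); [Andre1996Motifs] §3.2 Remarque (p. 21), §0.2 (p. 7);
[Fulton1998] §16.1 Prop. 16.1.1; [VoisinHodgeII2003] §9.2.4 Prop. 9.20; [Grothendieck1968] §3 p. 196.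
-/

noncomputable section

-- every declaration of this problem lives in `Summit.HodgeConjecture.HodgeConjecture.…` (summit = sub-problem)
set_option linter.dupNamespace false

open CategoryTheory AlgebraicGeometry
open Literature.AlgebraicGeometry.Motives Literature.AlgebraicGeometry.HodgeTheory
open Literature.Geometry.Kaehler (lefschetzPow HasHardLefschetzProperty)
open Summit.HodgeConjecture.HodgeConjecture.Ring2.AbelianAll

namespace Summit.HodgeConjecture.HodgeConjecture.Theorems.LefschetzStandardB

variable {d : ℕ} {Z : SchemeOver ℂ}

/-- `Hᵏ(Z(ℂ); ℂ)` is finite-dimensional for `Z` smooth projective (compact manifold; Hatcher App. A Cor. A.8–A.9).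
[cite: HatcherAT2002, Appendix A Cor. A.8–A.9 and §3.1 Cor. 3.3] -/
theorem finite_complexBetti_of_smoothProjective (hZ : IsSmoothProjective d Z) (k : ℕ) :
    Module.Finite ℂ (complexBetti Z k) := by
  letI := hZ.chartedSpace
  haveI := ComplexPoints.compactSpace_of_isSmoothProjective hZ
  haveI := ComplexPoints.t2Space_of_isSmoothProjective hZ
  exact Literature.AlgebraicTopology.SingularHomology.finite_singularCohomology_of_compact_chartedSpace ℂ ℂ
    (X := ComplexPoints Z) (d := 2 * d) k

/-- **Powers of an algebraic endo-correspondence composed with an algebraic correspondence are algebraic**: for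
`Z` smooth projective of dimension `d`, `u ∈ End Hᵇ(Z(ℂ); ℂ)` and `θ : Hᵃ(Z(ℂ); ℂ) → Hᵇ(Z(ℂ); ℂ)` algebraic
correspondences with `a ≤ b + 2d`, every `uᵏ ∘ θ` is an algebraic correspondence (induction on `k`; composition
`IsAlgebraicCorrespondence.comp`, Fulton Prop. 16.1.1). [cite: Fulton1998, §16.1 Prop. 16.1.1]
[cite: Kleiman1968AlgebraicCycles, §1.3 and Appendix to §2, proof of Thm. 2A11] -/
theorem isAlgebraicCorrespondence_pow_comp (hZ : IsSmoothProjective d Z) {a b : ℕ} (hab : a ≤ b + 2 * d)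
    {u : complexBetti Z b →ₗ[ℂ] complexBetti Z b} (hu : IsAlgebraicCorrespondence d d Z Z u)
    {θ : complexBetti Z a →ₗ[ℂ] complexBetti Z b} (hθ : IsAlgebraicCorrespondence d d Z Z θ) :
    ∀ k : ℕ, IsAlgebraicCorrespondence d d Z Z ((u ^ k) ∘ₗ θ)
  | 0 => by rwa [pow_zero, Module.End.one_eq_id, LinearMap.id_comp]
  | k + 1 => by
    rw [pow_succ', Module.End.mul_eq_comp, LinearMap.comp_assoc]
    exact IsAlgebraicCorrespondence.comp hZ hZ hZ (isAlgebraicCorrespondence_pow_comp hZ hab hu hθ k) hu hab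

/-- **Polynomials in an algebraic endo-correspondence, composed with an algebraic correspondence, are algebraic
correspondences**: `(Σ_{k ∈ s} c_k uᵏ) ∘ θ` (`IsAlgebraicCorrespondence.sum`). [cite: Kleiman1968AlgebraicCycles, Appendix to §2, proof of Thm. 2A11]
[cite: Andre1996Motifs, §2.1 (p. 14)] -/
theorem isAlgebraicCorrespondence_sum_smul_pow_comp (hZ : IsSmoothProjective d Z) {a b : ℕ} (hab : a ≤ b + 2 * d)
    {u : complexBetti Z b →ₗ[ℂ] complexBetti Z b} (hu : IsAlgebraicCorrespondence d d Z Z u)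
    {θ : complexBetti Z a →ₗ[ℂ] complexBetti Z b} (hθ : IsAlgebraicCorrespondence d d Z Z θ)
    (s : Finset ℕ) (c : ℕ → ℂ) :
    IsAlgebraicCorrespondence d d Z Z ((∑ k ∈ s, c k • u ^ k) ∘ₗ θ) := by
  have heq : (∑ k ∈ s, c k • u ^ k) ∘ₗ θ = ∑ k ∈ s, c k • ((u ^ k) ∘ₗ θ) := by
    refine LinearMap.ext fun x ↦ ?_
    simp only [LinearMap.comp_apply, LinearMap.sum_apply, LinearMap.smul_apply]
  rw [heq]
  exact IsAlgebraicCorrespondence.sum hZ hZ s c (fun k ↦ (u ^ k) ∘ₗ θ)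
    (isAlgebraicCorrespondence_pow_comp hZ hab hu hθ) 0

/-- **The inverse Lefschetz isomorphism is an algebraic correspondence as soon as SOME bijective algebraic
correspondence in its direction exists** (Kleiman 2A11, the heart of the transfer): for `Z` smooth projective of
dimension `d`, `η ∈ N¹ H²(Z(ℂ))` with the hard Lefschetz property in dimension `d`, `b + j = d`, and a bijective
algebraic correspondence `θ : H^{b+2j}(Z(ℂ); ℂ) → Hᵇ(Z(ℂ); ℂ)`, the inverse of `Lʲ : Hᵇ → H^{b+2j}` — André's
`*_L` on `H^{b+2j}` — is an algebraic correspondence: `u := θ ∘ Lʲ` is an algebraic, injective endomorphism of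
`Hᵇ`, `(Σ c_k uᵏ) ∘ u = 𝟙` by Cayley–Hamilton, and `*_L = (Σ c_k uᵏ) ∘ θ`.
[cite: Kleiman1968AlgebraicCycles, Appendix to §2, Thm. 2A11] [cite: Charles2013, Lemma 6 (arXiv:1002.5011)]
[cite: Andre1996Motifs, §3.2 Remarque (p. 21)] -/
theorem isAlgebraicCorrespondence_lefschetzInvolution_of_exists_bijective (hZ : IsSmoothProjective d Z)
    {η : complexBetti Z 2} (hη : IsPolarizationClass d Z η) {b j : ℕ} (hj : b + j = d)
    (hab : b + 2 * j + b = 2 * d)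
    {θ : complexBetti Z (b + 2 * j) →ₗ[ℂ] complexBetti Z b} (hθbij : Function.Bijective θ)
    (hθalg : IsAlgebraicCorrespondence d d Z Z θ) :
    IsAlgebraicCorrespondence d d Z Z (lefschetzInvolution hη.hasHardLefschetz hab) := by
  have hL : HasHardLefschetzProperty η d := hη.hasHardLefschetz
  have hLbij : Function.Bijective (lefschetzPow η j b) := hL j b hj
  -- `u = θ ∘ Lʲ`, an algebraic injective endomorphism of `Hᵇ`
  set u : complexBetti Z b →ₗ[ℂ] complexBetti Z b := θ ∘ₗ lefschetzPow η j b with hu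
  have hualg : IsAlgebraicCorrespondence d d Z Z u :=
    IsAlgebraicCorrespondence.comp_lefschetzPow hZ hZ hη.mem_algebraicClasses b j hθalg
  have huinj : Function.Injective u := by
    intro x y h
    have h' : θ (lefschetzPow η j b x) = θ (lefschetzPow η j b y) := by
      simpa only [hu, LinearMap.comp_apply] using h
    exact hLbij.1 (hθbij.1 h')
  -- Cayley–Hamilton: `(Σ c_k u^k) ∘ u = 𝟙`
  haveI := finite_complexBetti_of_smoothProjective hZ b
  obtain ⟨s, c, hinv⟩ := exists_sum_smul_pow_comp_eq_id u huinj
  -- `φ = (Σ c_k u^k) ∘ θ` is algebraic and inverts `Lʲ`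
  have hφalg : IsAlgebraicCorrespondence d d Z Z ((∑ k ∈ s, c k • u ^ k) ∘ₗ θ) :=
    isAlgebraicCorrespondence_sum_smul_pow_comp hZ (by omega) hualg hθalg s c
  have hφL : ((∑ k ∈ s, c k • u ^ k) ∘ₗ θ) ∘ₗ lefschetzPow η j b = LinearMap.id := by
    rw [LinearMap.comp_assoc]
    exact hinv
  have heq : lefschetzInvolution hη.hasHardLefschetz hab = (∑ k ∈ s, c k • u ^ k) ∘ₗ θ := by
    refine LinearMap.ext fun y ↦ ?_
    obtain ⟨x, rfl⟩ := hLbij.2 y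
    rw [lefschetzInvolution_lefschetzPow hL hj hab x]
    have hx := LinearMap.congr_fun hφL x
    rw [LinearMap.comp_apply, LinearMap.id_apply] at hx
    exact hx.symm
  rw [heq]
  exact hφalg

/-- **`B(Z)` in the degrees `Hᵃ → Hᵇ`, `a + b = 2d`, from ONE bijective algebraic correspondence `Hᵃ → Hᵇ`**
(binder form of `StandardConjectureBStar`; what the line's assembly extracts from Charles's spread, stub 3, at each
stage of its induction): for `a ≤ d` the lower half (`*_L = L^{d-a}`, no hypothesis used), for `d < a` the inverse
Lefschetz isomorphism by `isAlgebraicCorrespondence_lefschetzInvolution_of_exists_bijective`.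
[cite: Kleiman1968AlgebraicCycles, Appendix to §2, Thm. 2A11] [cite: Charles2013, Lemma 6 and Prop. 8 (arXiv:1002.5011)] -/
theorem isAlgebraicCorrespondence_lefschetzInvolution_of_exists_bijective_algebraic (hZ : IsSmoothProjective d Z)
    {η : complexBetti Z 2} (hη : IsPolarizationClass d Z η) {a b : ℕ} (hab : a + b = 2 * d)
    (hθ : ∃ θ : complexBetti Z a →ₗ[ℂ] complexBetti Z b, Function.Bijective θ ∧ IsAlgebraicCorrespondence d d Z Z θ) :
    IsAlgebraicCorrespondence d d Z Z (lefschetzInvolution hη.hasHardLefschetz hab) := by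
  rcases le_or_gt a d with ha | ha
  · exact isAlgebraicCorrespondence_lefschetzInvolution_of_le hZ hη hab ha
  obtain ⟨θ, hθbij, hθalg⟩ := hθ
  obtain ⟨j, hj⟩ : ∃ j, b + j = d := ⟨d - b, by omega⟩
  obtain rfl : a = b + 2 * j := by omega
  exact isAlgebraicCorrespondence_lefschetzInvolution_of_exists_bijective hZ hη hj hab hθbij hθalg

/-- **Stub 4 of crux `LefschetzStandardB` — Kleiman's Cayley–Hamilton transfer (registered signature, verbatim).**
For `Z` smooth projective of dimension `d`, a polarisation class `η` and `a + b = 2d`: if the Lefschetz involution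
`*_L : Hᵇ → Hᵃ` is an algebraic correspondence and SOME bijective algebraic correspondence `θ : Hᵃ → Hᵇ` exists, then
`*_L : Hᵃ(Z(ℂ); ℂ) → Hᵇ(Z(ℂ); ℂ)` is an algebraic correspondence: `u := θ ∘ *_L⁽ᵇ→ᵃ⁾` is algebraic and bijective,
`u⁻¹ = P(u)` by Cayley–Hamilton, `*_L⁽ᵃ→ᵇ⁾ = u⁻¹ ∘ θ` since `*_L ∘ *_L = 𝟙`. On the carriers
(`isAlgebraicCorrespondence_lefschetzInvolution_of_exists_bijective_algebraic`) the first hypothesis is not even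
consumed: for `a ≤ d` the conclusion is the lower half, for `d < a` the map `*_L⁽ᵇ→ᵃ⁾ = L^{d-b}` is used directly.
[cite: Kleiman1968AlgebraicCycles, Appendix to §2, Thm. 2A11] [cite: Charles2013, Lemma 6 (arXiv:1002.5011)]
[cite: Andre1996Motifs, §3.2 Remarque (p. 21)] -/
theorem stub_cayleyHamiltonTransfer :
    ∀ (d : ℕ) (Z : SchemeOver ℂ) (η : complexBetti Z 2), IsSmoothProjective d Z →
      ∀ (hη : IsPolarizationClass d Z η) (a b : ℕ) (hab : a + b = 2 * d) (hba : b + a = 2 * d),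
        IsAlgebraicCorrespondence d d Z Z (lefschetzInvolution hη.hasHardLefschetz hba) →
        (∃ θ : complexBetti Z a →ₗ[ℂ] complexBetti Z b,
            Function.Bijective θ ∧ IsAlgebraicCorrespondence d d Z Z θ) →
          IsAlgebraicCorrespondence d d Z Z (lefschetzInvolution hη.hasHardLefschetz hab) :=
  fun _ _ _ hZ hη _ _ hab _ _ hθ ↦
    isAlgebraicCorrespondence_lefschetzInvolution_of_exists_bijective_algebraic hZ hη hab hθ

end Summit.HodgeConjecture.HodgeConjecture.Theorems.LefschetzStandardB

end
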